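/-
Copyright (c) 2026 the pub-hodgecm-mathlib formalisation cell (harness21).  Prover seat hodgecm-mathlib-LH4-p16 (g2), req620 Track A «(D-RAM) FOUR-FRAME» squad
(STAGE-1b, row (2) of the piece `f_{T₊}`, the (β₂) road (R-36); β₂ sub-dealer LH4-p04 (g9) WORD 23:52:38Z «= ROAD K5∕K6»; MECH-K3 v1 §1 «the live row is the digit
line»: K5-C, fourth file), 2026-09-05.
-/
import Summits.HodgeConjecture.HodgeConjecture.Theorems.F0P3cDyRamRowCellFlipTransport    -- ★ p863246 (this seat): skew bookkeeping `isOrd_mul_iff_of_skew` &c.; brings ★ `dualGen_mul_left`, ★ DEFS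
import HarnessLib

/-!
# Crux `H413`, line LH4 «(D-RAM) FOUR-FRAME» — STAGE-1b, row (2), the (β₂) road (R-36), (ROW-INT) ∕ ‹CORE›, K5-C (4): «THE TRANSPORT ALONG THE DIGIT LINE» — the algebra of the
# multiplier `N = ρκ₂∕ρκ₁` between two points of the line `{Tr_ρ = 1}`: its skew, the new trace `t′ = t·(1 + τ)` and the new point `κ̂′`, with `|κ̂′ − κ₂| ≤ |κ̂ − κ₁|`

Cell `hodgecm-mathlib` (D-0151), FLOOR 0, crux item H413 = `stmt-HodgeConjecture-24833`, route of record `HCCMUnconditional`; squad F0∕P3c∕LH4; lane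
`--supports stmt-HodgeConjecture-24833 --as helper` (count-neutral; pays NO tier-0 row).  THEOREMS ONLY (no `def`, no instance, no notation, no `sorry`, default heartbeats);
★-only imports; states NO law; (β₂) stays a HYPOTHESIS.  DATUM-FREE one-field letters (`K` with `ρ` an involutive isometry; `Θ` enters only through `Θ`-fixedness hypotheses).
WHY (MECH-K3 v1 `F0/P3c/LH4/LH4-p16/g2/MECH-K3.v1.LH4p16g2.md` §1; sub-dealer «= ROAD K5∕K6», target ‹CORE.letter.v1› by name).  A row vertex `Λ = x₀𝒪_j` has `u₀ := h·x₀Θx₀` with unit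
trace `t := Tr_ρ u₀` and the point `κ̂ := ρu₀∕t` on the line `{Tr_ρ κ = 1}` (so `u₀ = t·ρκ̂`); the cells of the live row are the shells of `κ̂ = κ_min + V·ξ₀`.  The uniform fibration
(«fibres over two digits of one class are equinumerous») moves a vertex from near `κ₁` to near `κ₂` by a flip `ε` with `εΘε = N := ρκ₂∕ρκ₁` (realisable iff `κ₁, κ₂` have the same
`Q`-class, ★ p863223; the flipped lattice stays in the cell under the skew letter, ★ p863246).  THIS FILE is the exact algebra of that multiplier, once and for all:
* §1 the line: `ρκ = 1 − κ`; differences of line points are ANTI (`sub_map_eq_neg_of_trace_one`); `|κ₂| = |κ₁|` when `|κ₂ − κ₁| < |κ₁|`;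
* §2 the multiplier: `N − ρN = −(κ₂ − κ₁)∕(κ₁ρκ₁)` (`transportMul_sub_map_eq`) — so ★ p863246's skew letter reads `|κ₂ − κ₁| < R`; `|N| = 1`;
* §3 the new trace: `Tr_ρ(κ₂κ̂∕κ₁) = 1 + τ`, **`τ = (κ₂ − κ₁)(κ̂ − κ₁)∕(κ₁ρκ₁)`** (`trace_transport_eq`), `τ` doubly fixed, `|τ| ≤ |κ₂ − κ₁|·|κ̂ − κ₁|∕|κ₁|²`; with `u₀ = tρκ̂`:
  `N·u₀ = t·ρ(κ₂κ̂∕κ₁)`, so `t′ = t·(1 + τ)` (`newTrace_eq`);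
* §4 the new point: `κ̂′ := (κ₂κ̂∕κ₁)∕(1 + τ)` and **`κ̂′ − κ₂ = κ₂·((κ̂ − κ₁)∕κ₁ − τ)∕(1 + τ)`** (`newPoint_sub_eq`), hence **`|κ̂′ − κ₂| ≤ |κ̂ − κ₁|`** when `|κ₂ − κ₁| < |κ₁|` and
  `|κ̂ − κ₁| < |κ₁|` (`v_newPoint_sub_le`) — the transport loses NO precision; and `ρ(Nu₀)∕t′ = κ̂′` (`newPoint_eq`).
K5-C (5) (next) assembles these with ★ p863246 into the fibre injection `Λ ↦ ε • Λ` and the equality of fibre sizes.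
WHAT IS NOT CLAIMED: the lattice-level statement (K5-C (5)), the class condition, any count.
HONEST LABEL.  Count-neutral field ∕ valuation algebra; nothing printed is asserted; no census law is stated; `HC_CM` is proved only modulo the 7 printed citations (2 remaining named
inputs: hLiu418 = `stmt-HodgeConjecture-24832`, h413 = `stmt-HodgeConjecture-24833`) until rung 0 closes.
## References
* [Jacobowitz1962] R. Jacobowitz, *Hermitian forms over local fields*, Amer. J. Math. 84 (1962): §4.
* [Kottwitz1986BaseChangeUnits] R. E. Kottwitz, *Base change for unit elements of Hecke algebras*, Compositio Math. 60 (1986): §1 pp. 240–241.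
* [Serre1979] J.-P. Serre, *Local Fields*, GTM 67 (1979): Ch. III §3 Prop. 7, §6 Prop. 12; Ch. V §2 Prop. 3.
-/

set_option autoImplicit false

noncomputable section

namespace Summit.HodgeConjecture.HodgeConjecture.Cruxes.H413.F0P3cDyRamRowCellDigitTransport

open scoped Valued WithZero
open WithZero

variable {K : Type} [Field K] [Valued K ℤᵐ⁰] {ρ Θ : K →+* K}

/-! ## §1 The line `{Tr_ρ κ = 1}` -/

omit [Valued K ℤᵐ⁰] in
/-- On the line, `ρκ = 1 − κ`. [cite: Serre1979, Ch. III §3 Prop. 7] -/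
theorem map_eq_one_sub_of_trace_one {κ : K} (hκ : κ + ρ κ = 1) : ρ κ = 1 - κ := by linear_combination hκ

omit [Valued K ℤᵐ⁰] in
/-- **DIFFERENCES OF LINE POINTS ARE ANTI**: `Tr_ρ κ₁ = Tr_ρ κ₂ = 1` ⟹ `ρ(κ₂ − κ₁) = −(κ₂ − κ₁)`. [cite: Serre1979, Ch. III §3 Prop. 7] -/
theorem sub_map_eq_neg_of_trace_one {κ₁ κ₂ : K} (h₁ : κ₁ + ρ κ₁ = 1) (h₂ : κ₂ + ρ κ₂ = 1) : ρ (κ₂ - κ₁) = -(κ₂ - κ₁) := by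
  rw [map_sub]; linear_combination h₂ - h₁

omit [Valued K ℤᵐ⁰] in
/-- A product of two anti elements is `ρ`-fixed. [cite: Serre1979, Ch. III §3 Prop. 7] -/
theorem map_mul_of_anti {x y : K} (hx : ρ x = -x) (hy : ρ y = -y) : ρ (x * y) = x * y := by
  rw [map_mul, hx, hy, neg_mul_neg]

/-- **CLOSE LINE POINTS HAVE THE SAME SIZE**: `|κ₂ − κ₁| < |κ₁|` ⟹ `|κ₂| = |κ₁|`. [cite: Serre1979, Ch. III §6 Prop. 12] -/
theorem v_eq_of_v_sub_lt {κ₁ κ₂ : K} (h : Valued.v (κ₂ - κ₁) < Valued.v κ₁) : Valued.v κ₂ = Valued.v κ₁ := by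
  have e : κ₂ = κ₁ + (κ₂ - κ₁) := by ring
  rw [e, Valuation.map_add_eq_of_lt_left _ h]

/-! ## §2 The multiplier `N = ρκ₂∕ρκ₁` and its skew -/

omit [Valued K ℤᵐ⁰] in
/-- **THE SKEW OF THE MULTIPLIER**: `Tr_ρ κ₁ = Tr_ρ κ₂ = 1`, `ρ² = 1`, `κ₁ ≠ 0` ⟹ `ρκ₂∕ρκ₁ − ρ(ρκ₂∕ρκ₁) = −(κ₂ − κ₁)∕(κ₁·ρκ₁)`. [cite: Serre1979, Ch. III §3 Prop. 7] -/
theorem transportMul_sub_map_eq (hρρ : ∀ x, ρ (ρ x) = x) {κ₁ κ₂ : K} (h₁ : κ₁ + ρ κ₁ = 1) (h₂ : κ₂ + ρ κ₂ = 1) (hκ₁ : κ₁ ≠ 0) :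
    ρ κ₂ / ρ κ₁ - ρ (ρ κ₂ / ρ κ₁) = -(κ₂ - κ₁) / (κ₁ * ρ κ₁) := by
  have hρκ₁ : ρ κ₁ ≠ 0 := (map_ne_zero ρ).2 hκ₁
  rw [map_div₀, hρρ, hρρ, map_eq_one_sub_of_trace_one h₁, map_eq_one_sub_of_trace_one h₂]
  rw [map_eq_one_sub_of_trace_one h₁] at hρκ₁
  field_simp
  ring

/-- Its valuation: `|N − ρN| = |κ₂ − κ₁|∕|κ₁|²` (`ρ` isometric). [cite: Serre1979, Ch. III §6 Prop. 12] -/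
theorem v_transportMul_sub_map_eq (hρρ : ∀ x, ρ (ρ x) = x) (hvρ : ∀ x, Valued.v (ρ x) = Valued.v x) {κ₁ κ₂ : K} (h₁ : κ₁ + ρ κ₁ = 1) (h₂ : κ₂ + ρ κ₂ = 1)
    (hκ₁ : κ₁ ≠ 0) : Valued.v (ρ κ₂ / ρ κ₁ - ρ (ρ κ₂ / ρ κ₁)) = Valued.v (κ₂ - κ₁) / Valued.v κ₁ ^ 2 := by
  rw [transportMul_sub_map_eq hρρ h₁ h₂ hκ₁, map_div₀, Valuation.map_neg, Valuation.map_mul, hvρ, pow_two]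

/-- The multiplier is a UNIT when `|κ₂ − κ₁| < |κ₁|`: `|ρκ₂∕ρκ₁| = 1`. [cite: Serre1979, Ch. III §6 Prop. 12] -/
theorem v_transportMul_eq_one (hvρ : ∀ x, Valued.v (ρ x) = Valued.v x) {κ₁ κ₂ : K} (hκ₁ : κ₁ ≠ 0) (h : Valued.v (κ₂ - κ₁) < Valued.v κ₁) :
    Valued.v (ρ κ₂ / ρ κ₁) = 1 := by
  rw [map_div₀, hvρ, hvρ, v_eq_of_v_sub_lt h, div_self ((Valuation.ne_zero_iff _).2 hκ₁)]

/-! ## §3 The new trace `t′ = t·(1 + τ)` -/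

omit [Valued K ℤᵐ⁰] in
/-- **THE TRACE OF THE TRANSPORTED POINT**: for three line points `κ₁, κ₂, κ̂` (`κ₁ ≠ 0`, `ρκ₁ ≠ 0`): `Tr_ρ(κ₂κ̂∕κ₁) = 1 + (κ₂ − κ₁)(κ̂ − κ₁)∕(κ₁ρκ₁)`.
[cite: Serre1979, Ch. III §3 Prop. 7] -/
theorem trace_transport_eq {κ₁ κ₂ κ : K} (h₁ : κ₁ + ρ κ₁ = 1) (h₂ : κ₂ + ρ κ₂ = 1) (hκ : κ + ρ κ = 1) (hκ₁ : κ₁ ≠ 0) (hρκ₁ : ρ κ₁ ≠ 0) :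
    κ₂ * κ / κ₁ + ρ (κ₂ * κ / κ₁) = 1 + (κ₂ - κ₁) * (κ - κ₁) / (κ₁ * ρ κ₁) := by
  rw [map_div₀, map_mul, map_eq_one_sub_of_trace_one h₂, map_eq_one_sub_of_trace_one hκ]
  rw [map_eq_one_sub_of_trace_one h₁] at hρκ₁ ⊢
  field_simp
  ring

omit [Valued K ℤᵐ⁰] in
/-- The correction `τ = (κ₂ − κ₁)(κ̂ − κ₁)∕(κ₁ρκ₁)` is `ρ`-FIXED (product of two anti elements over a `ρ`-norm). [cite: Serre1979, Ch. III §3 Prop. 7] -/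
theorem map_tau_eq (hρρ : ∀ x, ρ (ρ x) = x) {κ₁ κ₂ κ : K} (h₁ : κ₁ + ρ κ₁ = 1) (h₂ : κ₂ + ρ κ₂ = 1) (hκ : κ + ρ κ = 1) :
    ρ ((κ₂ - κ₁) * (κ - κ₁) / (κ₁ * ρ κ₁)) = (κ₂ - κ₁) * (κ - κ₁) / (κ₁ * ρ κ₁) := by
  rw [map_div₀, map_mul_of_anti (sub_map_eq_neg_of_trace_one h₁ h₂) (sub_map_eq_neg_of_trace_one h₁ hκ), map_mul, hρρ, mul_comm (ρ κ₁) κ₁]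

omit [Valued K ℤᵐ⁰] in
/-- … and `Θ`-FIXED when the three points are. [cite: Serre1979, Ch. III §3 Prop. 7] -/
theorem mapTheta_tau_eq (hΘρ : ∀ x, Θ (ρ x) = ρ (Θ x)) {κ₁ κ₂ κ : K} (hΘ₁ : Θ κ₁ = κ₁) (hΘ₂ : Θ κ₂ = κ₂) (hΘκ : Θ κ = κ) :
    Θ ((κ₂ - κ₁) * (κ - κ₁) / (κ₁ * ρ κ₁)) = (κ₂ - κ₁) * (κ - κ₁) / (κ₁ * ρ κ₁) := by
  rw [map_div₀, map_mul, map_sub, map_sub, map_mul, hΘ₁, hΘ₂, hΘκ, hΘρ, hΘ₁]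

/-- The size of `τ`: `|τ| = |κ₂ − κ₁|·|κ̂ − κ₁|∕|κ₁|²`. [cite: Serre1979, Ch. III §6 Prop. 12] -/
theorem v_tau_eq (hvρ : ∀ x, Valued.v (ρ x) = Valued.v x) (κ₁ κ₂ κ : K) :
    Valued.v ((κ₂ - κ₁) * (κ - κ₁) / (κ₁ * ρ κ₁)) = Valued.v (κ₂ - κ₁) * Valued.v (κ - κ₁) / Valued.v κ₁ ^ 2 := by
  rw [map_div₀, Valuation.map_mul, Valuation.map_mul, hvρ, pow_two]

omit [Valued K ℤᵐ⁰] in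
/-- **`u₀ = t·ρκ̂`**: with `t = Tr_ρ u₀ ≠ 0`, `ρt = t`, `ρ² = 1` and `κ̂ = ρu₀∕t`. [cite: Jacobowitz1962, §4] -/
theorem eq_trace_mul_map_point (hρρ : ∀ x, ρ (ρ x) = x) {u₀ : K} (ht : u₀ + ρ u₀ ≠ 0) :
    u₀ = (u₀ + ρ u₀) * ρ (ρ u₀ / (u₀ + ρ u₀)) := by
  rw [map_div₀, hρρ, map_add, hρρ, add_comm (ρ u₀) u₀, mul_div_cancel₀ _ ht]

omit [Valued K ℤᵐ⁰] in
/-- **THE NEW TRACE**: `Tr_ρ(N·u₀) = t·Tr_ρ(κ₂κ̂∕κ₁)` for `N = ρκ₂∕ρκ₁`, `u₀ = tρκ̂`, `ρt = t`. [cite: Jacobowitz1962, §4] [cite: Serre1979, Ch. III §3 Prop. 7] -/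
theorem newTrace_eq (hρρ : ∀ x, ρ (ρ x) = x) {t κ κ₁ κ₂ : K} (hρt : ρ t = t) :
    ρ κ₂ / ρ κ₁ * (t * ρ κ) + ρ (ρ κ₂ / ρ κ₁ * (t * ρ κ)) = t * (κ₂ * κ / κ₁ + ρ (κ₂ * κ / κ₁)) := by
  simp only [map_mul, map_div₀, hρρ, hρt]
  ring

/-! ## §4 The new point `κ̂′` and the precision of the transport -/

omit [Valued K ℤᵐ⁰] in
/-- **THE NEW POINT**: `ρ(N·u₀)∕Tr_ρ(N·u₀) = (κ₂κ̂∕κ₁)∕Tr_ρ(κ₂κ̂∕κ₁)` (`t ≠ 0` cancels). [cite: Jacobowitz1962, §4] -/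
theorem newPoint_eq (hρρ : ∀ x, ρ (ρ x) = x) {t κ κ₁ κ₂ : K} (hρt : ρ t = t) (ht : t ≠ 0) :
    ρ (ρ κ₂ / ρ κ₁ * (t * ρ κ)) / (ρ κ₂ / ρ κ₁ * (t * ρ κ) + ρ (ρ κ₂ / ρ κ₁ * (t * ρ κ))) = (κ₂ * κ / κ₁) / (κ₂ * κ / κ₁ + ρ (κ₂ * κ / κ₁)) := by
  rw [newTrace_eq hρρ hρt]
  have hnum : ρ (ρ κ₂ / ρ κ₁ * (t * ρ κ)) = t * (κ₂ * κ / κ₁) := by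
    simp only [map_mul, map_div₀, hρρ, hρt]; ring
  rw [hnum, mul_div_mul_left _ _ ht]

omit [Valued K ℤᵐ⁰] in
/-- **THE DISPLACEMENT OF THE NEW POINT**: with `Tr_ρ(κ₂κ̂∕κ₁) = 1 + τ` (§3), `1 + τ ≠ 0`, `κ₁ ≠ 0`:
`(κ₂κ̂∕κ₁)∕(1 + τ) − κ₂ = κ₂·((κ̂ − κ₁)∕κ₁ − τ)∕(1 + τ)`. [cite: Serre1979, Ch. III §3 Prop. 7] -/
theorem newPoint_sub_eq {κ₁ κ₂ κ τ : K} (hκ₁ : κ₁ ≠ 0) (hτ : 1 + τ ≠ 0) :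
    κ₂ * κ / κ₁ / (1 + τ) - κ₂ = κ₂ * ((κ - κ₁) / κ₁ - τ) / (1 + τ) := by
  field_simp
  ring

/-- **THE TRANSPORT LOSES NO PRECISION.**  `ρ` an involutive isometry; `κ₁, κ₂, κ̂` on the line with `κ₁ ≠ 0`, `|κ₂ − κ₁| < |κ₁|` and `|κ̂ − κ₁| < |κ₁|` ⟹ with `1 + τ := Tr_ρ(κ₂κ̂∕κ₁)`:
`|τ| < 1`, `|1 + τ| = 1`, and **`|κ̂′ − κ₂| ≤ |κ̂ − κ₁|`**, `κ̂′ = (κ₂κ̂∕κ₁)∕(1 + τ)`. [cite: Serre1979, Ch. III §6 Prop. 12] [cite: Kottwitz1986BaseChangeUnits, §1 pp. 240–241] -/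
theorem v_newPoint_sub_le (hvρ : ∀ x, Valued.v (ρ x) = Valued.v x) {κ₁ κ₂ κ : K} (h₁ : κ₁ + ρ κ₁ = 1) (h₂ : κ₂ + ρ κ₂ = 1)
    (hκ : κ + ρ κ = 1) (hκ₁ : κ₁ ≠ 0) (h12 : Valued.v (κ₂ - κ₁) < Valued.v κ₁) (hκκ : Valued.v (κ - κ₁) < Valued.v κ₁) :
    Valued.v ((κ₂ - κ₁) * (κ - κ₁) / (κ₁ * ρ κ₁)) < 1 ∧ Valued.v (κ₂ * κ / κ₁ + ρ (κ₂ * κ / κ₁)) = 1 ∧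
      Valued.v (κ₂ * κ / κ₁ / (κ₂ * κ / κ₁ + ρ (κ₂ * κ / κ₁)) - κ₂) ≤ Valued.v (κ - κ₁) := by
  have hvκ₁ : Valued.v κ₁ ≠ 0 := (Valuation.ne_zero_iff _).2 hκ₁
  have hpos : (0 : ℤᵐ⁰) < Valued.v κ₁ := zero_lt_iff.2 hvκ₁
  have hρκ₁ : ρ κ₁ ≠ 0 := (map_ne_zero ρ).2 hκ₁
  set τ : K := (κ₂ - κ₁) * (κ - κ₁) / (κ₁ * ρ κ₁) with hτdef
  -- `|τ| < 1`
  have hτv : Valued.v τ = Valued.v (κ₂ - κ₁) * Valued.v (κ - κ₁) / Valued.v κ₁ ^ 2 := v_tau_eq hvρ κ₁ κ₂ κ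
  have hτlt : Valued.v τ < 1 := by
    rw [hτv, div_lt_one₀ (pow_pos hpos 2), pow_two]
    exact mul_lt_mul'' h12 hκκ zero_le zero_le
  have hT : κ₂ * κ / κ₁ + ρ (κ₂ * κ / κ₁) = 1 + τ := trace_transport_eq h₁ h₂ hκ hκ₁ hρκ₁
  have h1τ : Valued.v (1 + τ) = 1 := by rw [Valuation.map_add_eq_of_lt_left _ (by rwa [Valuation.map_one]), Valuation.map_one]
  have h1τ0 : 1 + τ ≠ 0 := fun h0 => by rw [h0, map_zero] at h1τ; exact zero_ne_one h1τ
  refine ⟨hτlt, by rw [hT, h1τ], ?_⟩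
  rw [hT, newPoint_sub_eq hκ₁ h1τ0, map_div₀, h1τ, div_one, Valuation.map_mul, v_eq_of_v_sub_lt h12]
  -- `|κ₁|·|(κ̂ − κ₁)∕κ₁ − τ| ≤ |κ̂ − κ₁|`
  have hC : Valued.v κ₁ * Valued.v τ ≤ Valued.v (κ - κ₁) := by
    rw [hτv, pow_two, mul_comm (Valued.v κ₁), div_mul_eq_mul_div, mul_div_mul_right _ _ hvκ₁, div_le_iff₀ hpos]
    calc Valued.v (κ₂ - κ₁) * Valued.v (κ - κ₁) ≤ Valued.v κ₁ * Valued.v (κ - κ₁) := mul_le_mul' h12.le le_rfl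
      _ = Valued.v (κ - κ₁) * Valued.v κ₁ := mul_comm _ _
  calc Valued.v κ₁ * Valued.v ((κ - κ₁) / κ₁ - τ) ≤ Valued.v κ₁ * max (Valued.v ((κ - κ₁) / κ₁)) (Valued.v τ) :=
        mul_le_mul' le_rfl (Valuation.map_sub _ _ _)
    _ = max (Valued.v κ₁ * Valued.v ((κ - κ₁) / κ₁)) (Valued.v κ₁ * Valued.v τ) := (max_mul_mul_left _ _ _).symm
    _ ≤ Valued.v (κ - κ₁) := max_le (le_of_eq (by rw [map_div₀, ← mul_div_assoc, mul_div_cancel_left₀ _ hvκ₁])) hC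

end Summit.HodgeConjecture.HodgeConjecture.Cruxes.H413.F0P3cDyRamRowCellDigitTransport

end
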